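import Summits.AtomisticToContinuum.Crystallization.Theorems.FreeSplittingCertificatesStrictSplittingRuleP1FluxForm

/-!
# `StrictSplittingRule` (stmt-AtomisticToContinuum-12560): flux identification, vertex-value form — the boundary term as a PURE 12 × 12 quadratic form per cell (P1 interpolant object, part 42)

Route `FreeSplittingCertificates`, crux r3 `StrictSplittingRule` (H12⋆ = `stub_coreJointCoercive`), unit b2b-freesplit-B gen 29.
VALUE = companion of part 41 (`…P1FluxForm`, `integral_flux_p1Disp_eq_tsum`): the element gradient of the far-ledger field is eliminated through the
hat-function gradients, `p1CellGrad U − A = Σ_m ∂λ_m ⊗ W_m` (`W` = vertex values of `p1Disp`; linear precision, via uniqueness of the derivative at an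
interior point of the cell), so the far theorem's boundary term becomes `Σ'_T p1FluxQuad(T)(W_T)` — a pure quadratic form in the twelve vertex values of
each collar cell, i.e. LITERALLY the `12 × 12` matrices the gen-29 interval engine `fluxform.py` encloses (HOME CERT §30).  NOT a proof of H12⋆, NOT
summit progress.  [folklore: P1 finite elements]
-/

noncomputable section

open Set Function Metric MeasureTheory Filter Topology
open scoped BigOperators NNReal ENNReal

namespace Summit.AtomisticToContinuum.Crystallization.Theorems.StrictSplittingRuleBirth

/-- The constant gradient of the hat function of vertex `m` of cell `i`: `∂ⱼλ_m = (linear part of λ_m) (T⁻¹-linear part applied to eⱼ)`. -/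
def p1LamGrad (a h : ℝ) (i : (ℤ × ℤ × ℤ) × Fin 6) (m : Fin 4) (j : Fin 3) : ℝ :=
  p1BaryCLM (p1Par i.1) i.2 m (p1ChartInvCLM a h i.1.1 (fpE j))

/-- **The cell gradient is the vertex values contracted with the hat gradients**: `G_{jk} = Σ_m ∂ⱼλ_m · W_{mk}`. -/
theorem p1CellGrad_eq_sum_p1LamGrad (a h : ℝ) (U : ℤ × ℤ × ℤ → (Fin 3 → ℝ)) (i : (ℤ × ℤ × ℤ) × Fin 6) (j k : Fin 3) :
    p1CellGrad a h U i j k = ∑ m : Fin 4, p1LamGrad a h i m j * p1CellVals U i m k := by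
  unfold p1CellGrad p1LamGrad p1CellVals
  rw [p1CellMap_apply, Finset.sum_apply]
  simp only [Pi.smul_apply, smul_eq_mul]

/-- The interior of a real cell is nonempty (it carries the cell's positive volume; the frontier is null). -/
theorem interior_p1RealCell_nonempty {a h : ℝ} (ha : 0 < a) (hh : 0 < h) (i : (ℤ × ℤ × ℤ) × Fin 6) :
    (interior (p1RealCell a h i)).Nonempty := by
  refine nonempty_of_measure_ne_zero (μ := volume) fun h0 => ?_
  have hnull : volume (p1RealCell a h i \ interior (p1RealCell a h i)) = 0 := by
    rw [← (isClosed_p1RealCell a h i).frontier_eq]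
    exact volume_frontier_p1RealCell ha.ne' hh.ne' i
  have h3 : 0 < √3 := Real.sqrt_pos.2 (by norm_num)
  have hpos : 0 < volume (p1RealCell a h i) := by
    rw [volume_p1RealCell ha hh i]
    exact ENNReal.ofReal_pos.2 (by positivity)
  have hle : volume (p1RealCell a h i) ≤
      volume (interior (p1RealCell a h i)) + volume (p1RealCell a h i \ interior (p1RealCell a h i)) :=
    calc volume (p1RealCell a h i)
        ≤ volume (interior (p1RealCell a h i) ∪ (p1RealCell a h i \ interior (p1RealCell a h i))) :=
          measure_mono fun x hx => by
            by_cases hi : x ∈ interior (p1RealCell a h i)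
            · exact Or.inl hi
            · exact Or.inr ⟨hx, hi⟩
      _ ≤ volume (interior (p1RealCell a h i)) + volume (p1RealCell a h i \ interior (p1RealCell a h i)) :=
          measure_union_le _ _
  rw [h0, hnull, zero_add] at hle
  exact absurd hle (not_le.2 hpos)

/-- **The element gradient of the far-ledger field through its vertex values**: on every cell `p1CellGrad U − A = Σ_m ∂λ_m ⊗ W_m` with `W` the
vertex values of `p1Disp` (`p1DispSite`; linear precision — the gradient of the affine part is reproduced exactly). -/
theorem p1CellGrad_sub_eq_sum_p1LamGrad {a h : ℝ} (ha : 0 < a) (hh : 0 < h) (U : ℤ × ℤ × ℤ → (Fin 3 → ℝ)) (b₀ : Fin 3 → ℝ)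
    (A : Fin 3 → Fin 3 → ℝ) (i : (ℤ × ℤ × ℤ) × Fin 6) :
    (fun j k => p1CellGrad a h U i j k - A j k) =
      fun j k => ∑ m : Fin 4, p1LamGrad a h i m j * p1CellVals (fun n k => p1DispSite a h U b₀ A n k) i m k := by
  obtain ⟨x, hx⟩ := interior_p1RealCell_nonempty ha hh i
  have h1 := fpGrad_p1Disp U b₀ A hx
  have h2 : fpGrad (p1Disp a h U b₀ A) x = p1CellGrad a h (fun n k => p1DispSite a h U b₀ A n k) i := by
    rw [p1Disp_eq_p1Field ha.ne' hh.ne' U b₀ A]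
    exact fpGrad_p1Field _ hx
  rw [← h1, h2]
  funext j k
  exact p1CellGrad_eq_sum_p1LamGrad a h _ i j k

/-- **The cell flux form as a PURE quadratic form of the twelve vertex values** (element gradient eliminated through `∂λ_m`): the object the
interval engine `fluxform.py` encloses entry by entry. -/
def p1FluxQuad (S1 S2 ca cb cc cn a h : ℝ) (i : (ℤ × ℤ × ℤ) × Fin 6) (W : Fin 4 → Fin 3 → ℝ) : ℝ :=
  p1FluxCellForm S1 S2 ca cb cc cn a h i W (fun j k => ∑ m : Fin 4, p1LamGrad a h i m j * W m k)

/-- **FLUX IDENTIFICATION, vertex-value form**: `∫ 2χ⟪∇χ, Φ(v)⟫ = Σ'_T p1FluxQuad(T)(W_T)` for the far-ledger field, `W_T` = its vertex values on cell `T`.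
NOT a proof of H12⋆, NOT summit progress. -/
theorem integral_flux_p1Disp_eq_tsum_quad {a h S1 S2 : ℝ} (ha : 0 < a) (hh : 0 < h) (hS1 : 0 < S1) (hS12 : S1 < S2)
    (ca cb cc cn : ℝ) (U : ℤ × ℤ × ℤ → (Fin 3 → ℝ)) (hU : (support U).Finite) (b₀ : Fin 3 → ℝ) (A : Fin 3 → Fin 3 → ℝ) :
    ∫ x, 2 * fpChi S1 S2 x * fpFlux4DotGrad ca cb cc cn (p1Disp a h U b₀ A) (fpChi S1 S2) x =
      ∑' i, p1FluxQuad S1 S2 ca cb cc cn a h i (p1CellVals (fun n k => p1DispSite a h U b₀ A n k) i) := by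
  rw [integral_flux_p1Disp_eq_tsum ha hh hS1 hS12 ca cb cc cn U hU b₀ A]
  refine tsum_congr fun i => ?_
  rw [p1FluxQuad, ← p1CellGrad_sub_eq_sum_p1LamGrad ha hh U b₀ A i]

/-- **Instance F2, vertex-value form.**  NOT a proof of H12⋆, NOT summit progress. -/
theorem integral_fluxF2_p1Disp_eq_tsum_quad {a h : ℝ} (ha : 0 < a) (hh : 0 < h) (U : ℤ × ℤ × ℤ → (Fin 3 → ℝ))
    (hU : (support U).Finite) (b₀ : Fin 3 → ℝ) (A : Fin 3 → Fin 3 → ℝ) {R1 R2 : ℝ} (hR1 : 0 < R1) (hR12 : R1 < R2) :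
    ∫ x, 2 * fpChi (R1 ^ 2) (R2 ^ 2) x * fpFlux4DotGrad (1 / 3) (4 / 3) (-9 / 8) (1 / 8) (p1Disp a h U b₀ A) (fpChi (R1 ^ 2) (R2 ^ 2)) x =
      ∑' i, p1FluxQuad (R1 ^ 2) (R2 ^ 2) (1 / 3) (4 / 3) (-9 / 8) (1 / 8) a h i (p1CellVals (fun n k => p1DispSite a h U b₀ A n k) i) :=
  integral_flux_p1Disp_eq_tsum_quad ha hh (pow_pos hR1 2) (pow_lt_pow_left₀ hR12 hR1.le two_ne_zero) _ _ _ _ U hU b₀ A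

end Summit.AtomisticToContinuum.Crystallization.Theorems.StrictSplittingRuleBirth

end
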